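import Summits.CriticalPhenomena.PercolationContinuityZ3.Theorems.PercNearOneGluingNoHeavyLowerTailMajorityGluingTypeTableScaledCone
import Summits.CriticalPhenomena.PercolationContinuityZ3.Theorems.PercNearOneGluingNoHeavyLowerTailMajorityGluingTypeTableFixedMRelaw
import Summits.CriticalPhenomena.PercolationContinuityZ3.Theorems.PercNearOneGluingNoHeavyLowerTailMajorityGluingConvexBootstrapCore
import HarnessLib

/-!
# Template S in the kernel: the scaled law of a case and the validity of the static rows
(lane prim-rate, constants-miner 1, gen 30; RIGOROUS-CERTIFICATION.md §4 (the `s₀`-scaling); census/g25/DERIVATIONS.md L1–L6, B0–B2)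

Support file for the closed crux `NoHeavyLowerTail` (stmt-CriticalPhenomena-4575), majority-gluing line; continuation of
`…TypeTableScaledDefs` / `…TypeTableScaledCone` and `…TypeTableFixedMRelaw` (`SymLaw`).  A LAW OF A CASE `cs = (w, pattern)` at hub
weight `0 < M ≤ M_top = 2^{-K/32}` (`SLaw K cs M x`): the symmetric hypotheses `SymLaw K M x`, the 27 `O`-rows, `E(x) > 0`, the
dominance `T_z ≤ T_w` and the bands `(1 + r_lo(z))T_z ≤ S_z ≤ (1 + r_hi(z))T_z`.  The SCALED LAW is `x̂ = Λ·x` with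
`Λ = (M_top/M)^{s₀} ≥ 1`, `s₀ = κ₀/(2−4p)`; in world B it is restricted to the complement of `LARGE_w` (`xs`).  This file proves
the validity of every STATIC row kind of template S for `x̂` resp. `xs` (`static_valid`): linear rows, `E`-row, dominance,
bands, junk / control rows, relay-root consequences — all homogeneous, hence inherited from `x` by scaling, and restricted to
`SMALL_w` when their coefficients on `LARGE_w` are nonnegative (`restrOK`).  The tangent rows are in `…TypeTableScaledIso` /
`…TypeTableScaledStar`.  No percolation, no sorries.  [cite: VandenbergHaggstromKahn2005, Thm. 1.3 (p. 6)]
-/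

namespace Summit.CriticalPhenomena.PercolationContinuityZ3.Theorems

namespace HubOnly
namespace TypeTable

open DType

noncomputable section

/-! ### The exponent `s₀`, the scale factor, the scaled law -/

/-- `c₄ = (3 + √(11/3))/2`. -/
abbrev C4r : ℝ := (3 + Real.sqrt (11 / 3)) / 2

/-- `s₀ = κ₀/(2 − 4p)` with `p = 1/c₄`, `κ₀ = 4p − 1` (`= 1.68614…`; THEOREM BOTTOM-3's `μ`-free scaling exponent). -/
def s0 : ℝ := (4 * (1 / C4r) - 1) / (2 - 4 * (1 / C4r))

/-- `1 < s₀` (…ConvexBootstrapCore). -/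
theorem one_lt_s0' : 1 < s0 := ConvexBootstrap.one_lt_s0

/-- `M_top = 2^{-K/32}`. -/
abbrev Mtop (K : ℕ) : ℝ := (2 : ℝ) ^ (-(K : ℝ) / 32)

/-- The scale factor `Λ = (M_top/M)^{s₀}`. -/
def scal (K : ℕ) (M : ℝ) : ℝ := (Mtop K / M) ^ s0

/-- The (restricted) scaled law: `Λ·x` on the support, `0` on `LARGE_w` in world B. -/
def xs (restricted : Bool) (K : ℕ) (M : ℝ) (w : ℕ) (x : DType → ℝ) : DType → ℝ :=
  fun τ => if restricted && τ.large w then 0 else scal K M * x τ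

variable {K : ℕ} {M : ℝ} {x : DType → ℝ}

/-- `M_top > 0`. -/
theorem Mtop_pos (K : ℕ) : 0 < Mtop K := by unfold Mtop; positivity

/-- `1 ≤ M_top/M` and `1 ≤ Λ`, `0 < Λ` for `0 < M ≤ M_top`. -/
theorem scal_facts (hM : 0 < M) (hMle : M ≤ Mtop K) : 1 ≤ Mtop K / M ∧ 1 ≤ scal K M ∧ 0 < scal K M := by
  have h1 : 1 ≤ Mtop K / M := by rw [le_div_iff₀ hM, one_mul]; exact hMle
  have h2 : 1 ≤ scal K M := Real.one_le_rpow h1 (le_trans zero_le_one one_lt_s0'.le)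
  exact ⟨h1, h2, lt_of_lt_of_le zero_lt_one h2⟩

/-- The unrestricted scaled law is `Λ·x`. -/
theorem xs_false (K : ℕ) (M : ℝ) (w : ℕ) (x : DType → ℝ) : xs false K M w x = fun τ => scal K M * x τ := by
  funext τ; simp [xs]

/-- The scaled law is nonnegative and vanishes off the support. -/
theorem xs_nonneg_supp (r : Bool) (w : ℕ) (hx : ∀ τ, 0 ≤ x τ) (hM : 0 < M) (hMle : M ≤ Mtop K) :
    (∀ τ, 0 ≤ xs r K M w x τ) ∧ (∀ τ, vset r w τ = false → xs r K M w x τ = 0) := by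
  obtain ⟨-, -, hpos⟩ := scal_facts hM hMle
  refine ⟨fun τ => ?_, fun τ hτ => ?_⟩
  · unfold xs; split
    · exact le_rfl
    · exact mul_nonneg hpos.le (hx τ)
  · unfold xs; unfold vset at hτ
    cases r <;> simp_all

/-- A homogeneous row passes to `Λ·x`: `lin φ x ≤ 0 ⟹ lin φ (Λ·x) ≤ 0`. -/
theorem lin_scal_nonpos {φ : DType → ℤ} (hpos : 0 < scal K M) (h : lin φ x ≤ 0) (w : ℕ) :
    lin φ (xs false K M w x) ≤ 0 := by
  rw [xs_false, lin_smul]; exact mul_nonpos_of_nonneg_of_nonpos hpos.le h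

/-- Restriction to `SMALL_w` keeps a row `≤ 0` whose coefficients on `LARGE_w` are nonnegative. -/
theorem lin_restrict_le {φ : DType → ℤ} {w : ℕ} (hφ : ∀ τ ∈ allTypes, τ.large w = true → 0 ≤ φ τ)
    {y : DType → ℝ} (hy : ∀ τ, 0 ≤ y τ) :
    lin φ (fun τ => if τ.large w then 0 else y τ) ≤ lin φ y := by
  unfold lin
  apply List.sum_le_sum
  intro τ hτ
  by_cases h : τ.large w = true
  · simp only [h, ↓reduceIte, mul_zero]
    exact mul_nonneg (by exact_mod_cast hφ τ hτ h) (hy τ)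
  · simp [h]

/-- A row kind's validity transfers from the unrestricted scaled law to the restricted one under `restrOK`. -/
theorem restrict_valid {φ : DType → ℤ} {w : ℕ} {r : Bool} (hok : restrOK r w φ = true) (hx : ∀ τ, 0 ≤ x τ)
    (hpos : 0 < scal K M) (h : lin φ (xs false K M w x) ≤ 0) : lin φ (xs r K M w x) ≤ 0 := by
  cases r
  · exact h
  · simp only [restrOK, Bool.not_true, Bool.false_or, List.all_eq_true, Bool.or_eq_true, Bool.not_eq_true',
      decide_eq_true_eq] at hok
    have e : xs true K M w x = fun τ => if τ.large w then 0 else (xs false K M w x) τ := by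
      funext τ; simp [xs]
    rw [e]
    refine le_trans (lin_restrict_le (fun τ hτ hl => ?_) (fun τ => ?_)) h
    · rcases hok τ hτ with h' | h'
      · rw [hl] at h'; exact absurd h' (by decide)
      · exact h'
    · rw [xs_false]; exact mul_nonneg hpos.le (hx τ)

/-! ### Laws of a case -/

/-- THE HYPOTHESES OF A CASE of the scaled programme on a law `x` at hub weights `0 < M ≤ 2^{-K/32}`: the symmetric
hypotheses, the 27 `O`-rows (WLOG order `δ₂ ≥ δ₃ ≥ δ₄` of the relay weights), `E(x) > 0`, the dominant relay `w`, and the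
richness bands of the pattern (`(1 + r_lo(z))·T_z ≤ S_z ≤ (1 + r_hi(z))·T_z`). -/
structure SLaw (K : ℕ) (cs : SCase) (M : ℝ) (x : DType → ℝ) : Prop extends SymLaw K M x where
  /-- the 27 `O`-rows -/
  ordRows : ∀ φ ∈ linOrd, lin φ x ≤ 0
  /-- positive objective (else nothing is to prove) -/
  Epos : 0 < E x
  /-- `w` is a relay -/
  wmem : cs.w ∈ [1, 2, 3, 4]
  /-- `w` carries the largest layer -/
  dom : ∀ z ∈ [1, 2, 3, 4], Tm z x ≤ Tm cs.w x
  /-- lower band edges -/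
  bandLo : ∀ z ∈ [1, 2, 3, 4], (1 + ((cs.bandOf z).lo : ℝ)) * Tm z x ≤ Sm z x
  /-- upper band edges -/
  bandHi : ∀ z ∈ [1, 2, 3, 4], ∀ h : ℚ, (cs.bandOf z).hi = some h → Sm z x ≤ (1 + (h : ℝ)) * Tm z x

variable {cs : SCase}

/-- The budgets of a case law. -/
theorem SLaw.budgets (L : SLaw K cs M x) :
    lin (fun τ => τ.bud 2) x ≤ 0 ∧ lin (fun τ => τ.bud 3) x ≤ 0 ∧ lin (fun τ => τ.bud 4) x ≤ 0 :=
  ⟨L.linRows _ (by simp [linFree]), L.linRows _ (by simp [linFree]), L.linRows _ (by simp [linFree])⟩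

/-- Every layer is positive (LEMMA B: `0 < E ≤ T_z`). -/
theorem SLaw.Tpos (L : SLaw K cs M x) : ∀ z ∈ [1, 2, 3, 4], 0 < Tm z x := by
  obtain ⟨hB2, hB3, hB4⟩ := L.budgets
  intro z hz
  exact lt_of_lt_of_le L.Epos (E_le_T_all x L.nonneg hB2 hB3 hB4 z hz)

/-- The scale factor of a case law: `1 ≤ Λ`, `0 < Λ`. -/
theorem SLaw.scal_pos (L : SLaw K cs M x) : 1 ≤ scal K M ∧ 0 < scal K M :=
  ⟨(scal_facts L.Mpos L.Mle).2.1, (scal_facts L.Mpos L.Mle).2.2⟩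

/-! ### Validity of the static rows for the scaled law -/

/-- `1 + h = num/den` for the integer pair `onePlusND h`, with `den > 0`. -/
theorem onePlusND_eq (h : ℚ) : ((onePlusND h).1 : ℝ) = (1 + (h : ℝ)) * ((onePlusND h).2 : ℝ) ∧ (0 : ℝ) < (onePlusND h).2 := by
  have hden : (0 : ℚ) < ((1 + h).den : ℚ) := by exact_mod_cast (1 + h).den_pos
  have e : ((1 + h).num : ℚ) = (1 + h) * ((1 + h).den : ℚ) := (Rat.mul_den_eq_num (1 + h)).symm
  refine ⟨?_, ?_⟩
  · have := congrArg (fun q : ℚ => (q : ℝ)) e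
    simp only [onePlusND] at this ⊢
    push_cast at this ⊢
    simpa using this
  · simp only [onePlusND]; exact_mod_cast hden

/-- Linear rows (`lin i`): the `O`-free rows and the `O`-rows hold for `x`, hence for `Λ·x`. -/
theorem valid_lin (L : SLaw K cs M x) (i : ℕ) : lin (linAll.getD i (fun _ => 0)) x ≤ 0 := by
  by_cases hi : i < linAll.length
  · have hmem : linAll.getD i (fun _ => 0) ∈ linAll := by
      rw [List.getD_eq_getElem _ _ hi]; exact List.getElem_mem hi
    rcases List.mem_append.mp hmem with h | h
    · exact L.linRows _ h
    · exact L.ordRows _ h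
  · rw [List.getD_eq_default _ _ (by omega)]
    exact le_of_eq (lin_eq_zero fun τ _ => rfl)

/-- The `E`-row: `lin (−e) x = −E(x) ≤ 0`. -/
theorem valid_erow (L : SLaw K cs M x) : lin (fun τ => -τ.eZ) x ≤ 0 := by
  have h := lin_combo [(-1, eZ)] x
  simp only [List.map_cons, List.map_nil, List.sum_cons, List.sum_nil, add_zero] at h
  have e : lin (fun τ => -τ.eZ) x = lin (combo [(-1, eZ)]) x :=
    lin_congr (fun τ _ => by simp [combo]) x
  rw [e, h]; push_cast
  have := L.Epos; simp only [E] at this; linarith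

/-- Dominance rows `T_z − T_w ≤ 0`. -/
theorem valid_dom (L : SLaw K cs M x) {z : ℕ} (hz : z ∈ [1, 2, 3, 4]) :
    lin (combo [(1, fun τ => ind (τ.isT z)), (-1, fun τ => ind (τ.isT cs.w))]) x ≤ 0 := by
  have h := L.dom z hz
  simp only [lin_combo, List.map_cons, List.map_nil, List.sum_cons, List.sum_nil]
  push_cast; simp only [Tm] at h; linarith

/-- Upper band rows `den·S_z − num·T_z ≤ 0`. -/
theorem valid_bandhi (L : SLaw K cs M x) {z : ℕ} (hz : z ∈ [1, 2, 3, 4]) {h : ℚ} (hh : (cs.bandOf z).hi = some h) :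
    lin (combo [((onePlusND h).2, fun τ => ind (τ.isS z)), (-(onePlusND h).1, fun τ => ind (τ.isT z))]) x ≤ 0 := by
  have hb := L.bandHi z hz h hh
  obtain ⟨e, hden⟩ := onePlusND_eq h
  simp only [lin_combo, List.map_cons, List.map_nil, List.sum_cons, List.sum_nil]
  push_cast; simp only [Sm, Tm] at hb
  rw [e]
  have := mul_le_mul_of_nonneg_right hb hden.le
  nlinarith

/-- Lower band rows `num·T_z − den·S_z ≤ 0` (`num/den = 1 + r_lo(z)`). -/
theorem valid_bandlo (L : SLaw K cs M x) {z : ℕ} (hz : z ∈ [1, 2, 3, 4]) :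
    lin (combo [((onePlusND (cs.bandOf z).lo).1, fun τ => ind (τ.isT z)),
      (-(onePlusND (cs.bandOf z).lo).2, fun τ => ind (τ.isS z))]) x ≤ 0 := by
  have hb := L.bandLo z hz
  obtain ⟨e, hden⟩ := onePlusND_eq (cs.bandOf z).lo
  simp only [lin_combo, List.map_cons, List.map_nil, List.sum_cons, List.sum_nil]
  push_cast; simp only [Sm, Tm] at hb
  rw [e]
  have := mul_le_mul_of_nonneg_right hb hden.le
  nlinarith

/-- Junk rows with and without the `E` term. -/
theorem valid_junk (L : SLaw K cs M x) {z : ℕ} (hz : z ∈ [1, 2, 3, 4]) :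
    lin (combo [(1, fun τ => ind (τ.isS z)), (-1, fun τ => ind (τ.isT z)), (1, eZ), (-1, fun τ => ind (τ.junk z))]) x ≤ 0 ∧
    lin (combo [(1, fun τ => ind (τ.isS z)), (-1, fun τ => ind (τ.isT z)), (-1, fun τ => ind (τ.junk z))]) x ≤ 0 := by
  obtain ⟨hB2, hB3, hB4⟩ := L.budgets
  have h1 := junk_row_valid x L.nonneg hB2 hB3 hB4 hz
  refine ⟨h1, ?_⟩
  simp only [lin_combo, List.map_cons, List.map_nil, List.sum_cons, List.sum_nil] at h1 ⊢
  push_cast at h1 ⊢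
  have := L.Epos; simp only [E] at this; linarith

/-- Control rows with and without the `E` term (`x(CTRL_z) ≤ T_z − E`). -/
theorem valid_ctrl (L : SLaw K cs M x) {z : ℕ} (hz : z ∈ [1, 2, 3, 4]) :
    lin (combo [(1, fun τ => ind (τ.ctrl z)), (-1, fun τ => ind (τ.isT z)), (1, eZ)]) x ≤ 0 ∧
    lin (combo [(1, fun τ => ind (τ.ctrl z)), (-1, fun τ => ind (τ.isT z))]) x ≤ 0 := by
  obtain ⟨hB2, hB3, hB4⟩ := L.budgets
  have h := ctrl_le x hB2 hB3 hB4 z hz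
  have hE := L.Epos
  simp only [Tm, E] at h hE
  simp only [lin_combo, List.map_cons, List.map_nil, List.sum_cons, List.sum_nil]
  push_cast
  exact ⟨by linarith, by linarith⟩

/-- Relay-root consequence `P_{zy} ≤ (1 + r_hi(z))·C_{zy}`: from the reduced relay-root row `(C+P)T_z ≤ C(T_z+S_z)`, the band
`S_z ≤ (1+h)T_z` and `T_z > 0`. -/
theorem P_le_C_of_band {T S C P h : ℝ} (hT : 0 < T) (hC : 0 ≤ C) (hS : S ≤ (1 + h) * T)
    (rel : (C + P) * T ≤ C * (T + S)) : P ≤ (1 + h) * C := by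
  have h1 : C * S ≤ C * ((1 + h) * T) := mul_le_mul_of_nonneg_left hS hC
  have h2 : P * T ≤ C * S := by nlinarith
  have h3 : P * T ≤ ((1 + h) * C) * T := by nlinarith
  exact le_of_mul_le_mul_right h3 hT

/-- Relay rows `den·P_{zy} − num·C_{zy} ≤ 0`. -/
theorem valid_relay (L : SLaw K cs M x) {z y : ℕ} (hz : z ∈ [1, 2, 3, 4]) (hy : y ∈ [1, 2, 3, 4]) (hzy : z ≠ y)
    {h : ℚ} (hh : (cs.bandOf z).hi = some h) :
    lin (combo [((onePlusND h).2, fun τ => ind (τ.isP z y)), (-(onePlusND h).1, fun τ => ind (τ.isC z y))]) x ≤ 0 := by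
  have hband := L.bandHi z hz h hh
  have hrel := L.rel z hz y hy hzy
  have hP := P_le_C_of_band (L.Tpos z hz) (lin_ind_nonneg _ L.nonneg) hband hrel
  obtain ⟨e, hden⟩ := onePlusND_eq h
  simp only [lin_combo, List.map_cons, List.map_nil, List.sum_cons, List.sum_nil]
  push_cast; simp only [Pm] at hP
  rw [e]
  have := mul_le_mul_of_nonneg_right hP hden.le
  nlinarith

/-- A row kind is STATIC if it is neither a tangent / STAR row nor a box row. -/
def SRow.isStatic : SRow → Bool
  | .tan _ => false
  | .star .. => false
  | .starB .. => false
  | .box _ _ => false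
  | _ => true

/-- **Validity of the static rows for the scaled law.**  Every static row kind accepted by `SRow.ok K cs r` holds for the
(restricted) scaled law `xs r K M w x` of every law of the case. -/
theorem static_valid (L : SLaw K cs M x) {r : Bool} (row : SRow) (hst : row.isStatic = true)
    (hok : row.ok K cs r = true) : lin (row.toRow cs).φ (xs r K M cs.w x) ≤ ((row.toRow cs).b : ℝ) := by
  have hx := L.nonneg
  obtain ⟨-, hpos⟩ := L.scal_pos
  -- every static row has right-hand side 0 and is homogeneous: reduce to the unscaled law, then restrict
  have main : ∀ (φ : DType → ℤ), restrOK r cs.w φ = true → lin φ x ≤ 0 → lin φ (xs r K M cs.w x) ≤ ((0 : ℚ) : ℝ) := by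
    intro φ hφ h
    rw [Rat.cast_zero]
    exact restrict_valid hφ hx hpos (lin_scal_nonpos hpos h cs.w)
  cases row with
  | lin i =>
    simp only [SRow.ok, Bool.and_eq_true, decide_eq_true_eq] at hok
    exact main _ hok.2 (valid_lin L i)
  | erow => exact main _ hok (valid_erow L)
  | dom z =>
    simp only [SRow.ok, Bool.and_eq_true, decide_eq_true_eq, Bool.not_eq_true'] at hok
    exact main _ hok.2 (valid_dom L hok.1.1.1)
  | bandhi z =>
    simp only [SRow.ok, Bool.and_eq_true, decide_eq_true_eq] at hok
    obtain ⟨⟨hz, hsome⟩, hφ⟩ := hok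
    obtain ⟨h, hh⟩ := Option.isSome_iff_exists.mp hsome
    have e : (SRow.bandhi z).toRow cs =
        ⟨combo [((onePlusND h).2, fun τ => ind (τ.isS z)), (-(onePlusND h).1, fun τ => ind (τ.isT z))], 0⟩ := by
      simp only [SRow.toRow, hh]
    rw [e] at hφ ⊢
    exact main _ hφ (valid_bandhi L hz hh)
  | bandlo z =>
    simp only [SRow.ok, Bool.and_eq_true, decide_eq_true_eq] at hok
    exact main _ hok.2 (valid_bandlo L hok.1)
  | junkE z =>
    simp only [SRow.ok, Bool.and_eq_true, decide_eq_true_eq] at hok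
    exact main _ hok.2 (valid_junk L hok.1).1
  | junk0 z =>
    simp only [SRow.ok, Bool.and_eq_true, decide_eq_true_eq] at hok
    exact main _ hok.2 (valid_junk L hok.1).2
  | ctrlE z =>
    simp only [SRow.ok, Bool.and_eq_true, decide_eq_true_eq] at hok
    exact main _ hok.2 (valid_ctrl L hok.1).1
  | ctrl0 z =>
    simp only [SRow.ok, Bool.and_eq_true, decide_eq_true_eq] at hok
    exact main _ hok.2 (valid_ctrl L hok.1).2
  | relay z y =>
    simp only [SRow.ok, Bool.and_eq_true, decide_eq_true_eq, Bool.not_eq_true'] at hok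
    obtain ⟨⟨⟨⟨hz, hy⟩, hzy⟩, hsome⟩, hφ⟩ := hok
    obtain ⟨h, hh⟩ := Option.isSome_iff_exists.mp hsome
    have hzy' : z ≠ y := by simpa using hzy
    have e : (SRow.relay z y).toRow cs =
        ⟨combo [((onePlusND h).2, fun τ => ind (τ.isP z y)), (-(onePlusND h).1, fun τ => ind (τ.isC z y))], 0⟩ := by
      simp only [SRow.toRow, hh]
    rw [e] at hφ ⊢
    exact main _ hφ (valid_relay L hz hy hzy' hh)
  | tan _ => simp [SRow.isStatic] at hst
  | star _ _ _ _ _ _ => simp [SRow.isStatic] at hst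
  | starB _ _ _ _ _ _ => simp [SRow.isStatic] at hst
  | box _ _ => simp [SRow.isStatic] at hst

end

end TypeTable
end HubOnly

end Summit.CriticalPhenomena.PercolationContinuityZ3.Theorems
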